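import Summits.Ventures.PercRepro.GZ24Final
import Summits.Ventures.PercRepro.OrbitClasses
import Summits.Ventures.PercRepro.ClassSwapA

/-!
# PercRepro — the class-level swap principle, part B: GZ24 eq. (final) on every class and ORBIT-2 with constant 1 (typer-2, gen 6; split gen 7)

The second half of the gen-6 module `ClassSwap` (split at the section boundary for the 400-line landing lint; every proof
byte-identical): the antipodal pairs of an interval and the swap (`antipodalPairs`, `swapPair_mem_antipodalPairs`,
`sum_antipodalPairs_swapPair`) live in `ClassSwapA`; this file carries **`gz24_final_classes`** (Gladkov–Zimin eq. (final)
on every interval), **`orbit2_const_one`** and **`Orbit2ConstOne`** / **`Orbit2ConstOne_holds`** (ORBIT-2 with constant 1 on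
every class of every multigraph — the class-level twin of p5's `c021_const_one`).
-/

namespace PercRepro

open Finset Classical

/-! ### Gladkov–Zimin eq. (final) on every class -/

namespace MultiGraph

variable {V E : Type*} (G : MultiGraph V E) [Fintype E] [DecidableEq E]

/-- **GZ24 eq. (final) on every interval** (p5's `indicator_bound` summed over the antipodal pairs): with
`P = antipodalPairs u v`,
`#{(ω, ω') ∈ P : ω ∈ a|b ∩ a|c ∧ ω' ∈ ab ∪ ac} ≤ #{(ω, ω') ∈ P : ω' ∈ ab|c} + #{… : ω' ∈ ac|b} + #{… : ω ∈ bc|a}`. -/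
theorem gz24_final_classes (a b c : V) (u v : Config E) :
    pairCountIn u v (G.sepEvent a b ∩ G.sepEvent a c) (G.connEvent a b ∪ G.connEvent a c) ≤
      pairCountSnd u v (G.connEvent a b ∩ G.sepEvent a c) +
        pairCountSnd u v (G.connEvent a c ∩ G.sepEvent a b) +
        pairCountFst u v (G.connEvent b c ∩ G.sepEvent a b) := by
  have key : (pairCountIn u v (G.sepEvent a b ∩ G.sepEvent a c)
      (G.connEvent a b ∪ G.connEvent a c) : ℝ) ≤
      (pairCountSnd u v (G.connEvent a b ∩ G.sepEvent a c) : ℝ) +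
        pairCountSnd u v (G.connEvent a c ∩ G.sepEvent a b) +
        pairCountFst u v (G.connEvent b c ∩ G.sepEvent a b) := by
    rw [← sum_antipodalPairs_indicator_mul, ← sum_antipodalPairs_indicator_snd,
      ← sum_antipodalPairs_indicator_snd, ← sum_antipodalPairs_indicator_fst,
      ← sum_antipodalPairs_swapPair (recoverable_swapSetBC (G := G) a b c)
        (fun ω ω' => (G.sepEvent a b ∩ G.sepEvent a c).indicator 1 ω *
          (G.connEvent a b ∪ G.connEvent a c).indicator 1 ω') u v,
      ← sum_antipodalPairs_swapPair (recoverable_swapSetC (G := G) a b c)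
        (fun _ ω' => (G.connEvent a b ∩ G.sepEvent a c).indicator (1 : Config E → ℝ) ω') u v,
      ← sum_antipodalPairs_swapPair (recoverable_swapSetC (G := G) a c b)
        (fun _ ω' => (G.connEvent a c ∩ G.sepEvent a b).indicator (1 : Config E → ℝ) ω') u v,
      ← Finset.sum_add_distrib, ← Finset.sum_add_distrib]
    refine Finset.sum_le_sum fun x _ => ?_
    exact indicator_bound (G := G) x.1 x.2 a b c
  exact_mod_cast key

/-! ### ORBIT-2 with constant 1 -/

/-- The number of `A ≤ D` with `I ⊔ A ∈ X` (classical decidability, fixed once here). -/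
noncomputable def intervalCountIn (I D : Config E) (X : Set (Config E)) : ℕ :=
  (univ.filter fun A : Config E => A ≤ D ∧ I ⊔ A ∈ X).card

/-- The interval `[I, I ⊔ D]` as antipodal pairs: `A ≤ D` gives the pair `(I ⊔ (D ⊓ Aᶜ), I ⊔ A)`. -/
theorem pair_mem_antipodalPairs {I D A : Config E} (hA : A ≤ D) :
    (I ⊔ (D ⊓ Aᶜ), I ⊔ A) ∈ antipodalPairs (I ⊔ D) I := by
  rw [mem_antipodalPairs]
  constructor
  · calc (I ⊔ (D ⊓ Aᶜ)) ⊓ (I ⊔ A) = I ⊔ ((D ⊓ Aᶜ) ⊓ A) := (sup_inf_left I (D ⊓ Aᶜ) A).symm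
      _ = I := by rw [inf_assoc, compl_inf_self, inf_bot_eq, sup_bot_eq]
  · calc (I ⊔ (D ⊓ Aᶜ)) ⊔ (I ⊔ A) = I ⊔ ((D ⊓ Aᶜ) ⊔ A) := by
          rw [sup_sup_sup_comm, sup_idem]
      _ = I ⊔ ((D ⊔ A) ⊓ (Aᶜ ⊔ A)) := by rw [sup_inf_right]
      _ = I ⊔ D := by rw [compl_sup_eq_top, inf_top_eq, sup_eq_left.mpr hA]

/-- An antipodal pair of `[I, I ⊔ D]` is read off its second coordinate: `ω' = I ⊔ (ω' ⊓ D)`. -/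
theorem snd_eq_sup_inf_of_mem_antipodalPairs {I D : Config E} {x : Config E × Config E}
    (hx : x ∈ antipodalPairs (I ⊔ D) I) : x.2 = I ⊔ (x.2 ⊓ D) := by
  rw [mem_antipodalPairs] at hx
  have h1 : I ≤ x.2 := hx.1 ▸ inf_le_right
  have h2 : x.2 ≤ I ⊔ D := hx.2 ▸ le_sup_right
  calc x.2 = x.2 ⊓ (I ⊔ D) := (inf_eq_left.mpr h2).symm
    _ = (x.2 ⊓ I) ⊔ (x.2 ⊓ D) := inf_sup_left x.2 I D
    _ = I ⊔ (x.2 ⊓ D) := by rw [inf_eq_right.mpr h1]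

/-- An antipodal pair of `[I, I ⊔ D]` is read off its first coordinate: `ω = I ⊔ (ω ⊓ D)`. -/
theorem fst_eq_sup_inf_of_mem_antipodalPairs {I D : Config E} {x : Config E × Config E}
    (hx : x ∈ antipodalPairs (I ⊔ D) I) : x.1 = I ⊔ (x.1 ⊓ D) := by
  rw [mem_antipodalPairs] at hx
  have h1 : I ≤ x.1 := hx.1 ▸ inf_le_left
  have h2 : x.1 ≤ I ⊔ D := hx.2 ▸ le_sup_left
  calc x.1 = x.1 ⊓ (I ⊔ D) := (inf_eq_left.mpr h2).symm
    _ = (x.1 ⊓ I) ⊔ (x.1 ⊓ D) := inf_sup_left x.1 I D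
    _ = I ⊔ (x.1 ⊓ D) := by rw [inf_eq_right.mpr h1]

/-- The first coordinate of an antipodal pair of `[I, I ⊔ D]` is determined by the second. -/
theorem fst_eq_of_mem_antipodalPairs {I D : Config E} (hID : I ⊓ D = ⊥) {x y : Config E × Config E}
    (hx : x ∈ antipodalPairs (I ⊔ D) I) (hy : y ∈ antipodalPairs (I ⊔ D) I) (h : x.2 = y.2) :
    x.1 = y.1 := by
  rw [mem_antipodalPairs] at hx hy
  funext e
  have hxe := congrFun hx.1 e
  have hxe' := congrFun hx.2 e
  have hye := congrFun hy.1 e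
  have hye' := congrFun hy.2 e
  have hIDe := congrFun hID e
  have he := congrFun h e
  simp only [Pi.inf_apply, Pi.sup_apply, Pi.bot_apply] at hxe hxe' hye hye' hIDe he
  revert hxe hxe' hye hye' hIDe he
  cases x.1 e <;> cases x.2 e <;> cases y.1 e <;> cases y.2 e <;> cases I e <;> cases D e <;> decide

/-- The second coordinate of an antipodal pair of `[I, I ⊔ D]` is determined by the first. -/
theorem snd_eq_of_mem_antipodalPairs {I D : Config E} (hID : I ⊓ D = ⊥) {x y : Config E × Config E}
    (hx : x ∈ antipodalPairs (I ⊔ D) I) (hy : y ∈ antipodalPairs (I ⊔ D) I) (h : x.1 = y.1) :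
    x.2 = y.2 := by
  rw [mem_antipodalPairs] at hx hy
  funext e
  have hxe := congrFun hx.1 e
  have hxe' := congrFun hx.2 e
  have hye := congrFun hy.1 e
  have hye' := congrFun hy.2 e
  have hIDe := congrFun hID e
  have he := congrFun h e
  simp only [Pi.inf_apply, Pi.sup_apply, Pi.bot_apply] at hxe hxe' hye hye' hIDe he
  revert hxe hxe' hye hye' hIDe he
  cases x.1 e <;> cases x.2 e <;> cases y.1 e <;> cases y.2 e <;> cases I e <;> cases D e <;> decide

/-- `#{(ω, ω') ∈ P : ω' ∈ X} ≤ #{A ≤ D : I ⊔ A ∈ X}` — the pairs inject into the interval through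
`A = ω' ⊓ D`. -/
theorem pairCountSnd_le_intervalCountIn {I D : Config E} (hID : I ⊓ D = ⊥) (X : Set (Config E)) :
    pairCountSnd (I ⊔ D) I X ≤ intervalCountIn I D X := by
  unfold pairCountSnd intervalCountIn
  refine Finset.card_le_card_of_injOn (fun x => x.2 ⊓ D) ?_ ?_
  · intro x hx
    rw [Finset.mem_coe, Finset.mem_filter] at hx
    rw [Finset.mem_coe, Finset.mem_filter]
    refine ⟨Finset.mem_univ _, inf_le_right, ?_⟩
    rw [← snd_eq_sup_inf_of_mem_antipodalPairs hx.1]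
    exact hx.2
  · intro x hx y hy hxy
    rw [Finset.mem_coe, Finset.mem_filter] at hx hy
    have h2 : x.2 = y.2 := by
      rw [snd_eq_sup_inf_of_mem_antipodalPairs hx.1, snd_eq_sup_inf_of_mem_antipodalPairs hy.1]
      exact congrArg (I ⊔ ·) hxy
    exact Prod.ext (fst_eq_of_mem_antipodalPairs hID hx.1 hy.1 h2) h2

/-- `#{(ω, ω') ∈ P : ω ∈ X} ≤ #{A ≤ D : I ⊔ A ∈ X}` — through `A = ω ⊓ D`. -/
theorem pairCountFst_le_intervalCountIn {I D : Config E} (hID : I ⊓ D = ⊥) (X : Set (Config E)) :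
    pairCountFst (I ⊔ D) I X ≤ intervalCountIn I D X := by
  unfold pairCountFst intervalCountIn
  refine Finset.card_le_card_of_injOn (fun x => x.1 ⊓ D) ?_ ?_
  · intro x hx
    rw [Finset.mem_coe, Finset.mem_filter] at hx
    rw [Finset.mem_coe, Finset.mem_filter]
    refine ⟨Finset.mem_univ _, inf_le_right, ?_⟩
    rw [← fst_eq_sup_inf_of_mem_antipodalPairs hx.1]
    exact hx.2
  · intro x hx y hy hxy
    rw [Finset.mem_coe, Finset.mem_filter] at hx hy
    have h1 : x.1 = y.1 := by
      rw [fst_eq_sup_inf_of_mem_antipodalPairs hx.1, fst_eq_sup_inf_of_mem_antipodalPairs hy.1]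
      exact congrArg (I ⊔ ·) hxy
    exact Prod.ext h1 (snd_eq_of_mem_antipodalPairs hID hx.1 hy.1 h1)

/-- Three pairwise disjoint events inside `Y` count at most `Y` on the interval. -/
theorem intervalCountIn_three_le (I D : Config E) (X₁ X₂ X₃ Y : Set (Config E))
    (h12 : ∀ ω, ω ∈ X₁ → ω ∉ X₂) (h13 : ∀ ω, ω ∈ X₁ → ω ∉ X₃) (h23 : ∀ ω, ω ∈ X₂ → ω ∉ X₃)
    (hY : ∀ ω, ω ∈ X₁ ∨ ω ∈ X₂ ∨ ω ∈ X₃ → ω ∈ Y) :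
    intervalCountIn I D X₁ + intervalCountIn I D X₂ + intervalCountIn I D X₃ ≤
      intervalCountIn I D Y := by
  unfold intervalCountIn
  have d12 : Disjoint (univ.filter fun A : Config E => A ≤ D ∧ I ⊔ A ∈ X₁)
      (univ.filter fun A : Config E => A ≤ D ∧ I ⊔ A ∈ X₂) := by
    rw [Finset.disjoint_left]
    intro A h1 h2
    rw [Finset.mem_filter] at h1 h2
    exact h12 _ h1.2.2 h2.2.2
  have d123 : Disjoint ((univ.filter fun A : Config E => A ≤ D ∧ I ⊔ A ∈ X₁) ∪
      (univ.filter fun A : Config E => A ≤ D ∧ I ⊔ A ∈ X₂))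
      (univ.filter fun A : Config E => A ≤ D ∧ I ⊔ A ∈ X₃) := by
    rw [Finset.disjoint_left]
    intro A h h3
    rw [Finset.mem_union, Finset.mem_filter, Finset.mem_filter] at h
    rw [Finset.mem_filter] at h3
    rcases h with h1 | h2
    · exact h13 _ h1.2.2 h3.2.2
    · exact h23 _ h2.2.2 h3.2.2
  rw [← Finset.card_union_of_disjoint d12, ← Finset.card_union_of_disjoint d123]
  refine Finset.card_le_card fun A hA => ?_
  rw [Finset.mem_union, Finset.mem_union, Finset.mem_filter, Finset.mem_filter,
    Finset.mem_filter] at hA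
  rw [Finset.mem_filter]
  rcases hA with (⟨_, hAD, h1⟩ | ⟨_, hAD, h2⟩) | ⟨_, hAD, h3⟩
  · exact ⟨Finset.mem_univ _, hAD, hY _ (Or.inl h1)⟩
  · exact ⟨Finset.mem_univ _, hAD, hY _ (Or.inr (Or.inl h2))⟩
  · exact ⟨Finset.mem_univ _, hAD, hY _ (Or.inr (Or.inr h3))⟩

variable [DecidableEq V] [Fintype V]

/-- `a₁₃ ≤ #{(ω, ω') ∈ P : ω ∈ a|b ∩ a|c ∧ ω' ∈ ab ∪ ac}` — the antipodal `(1, 3)` pairs inject into the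
antipodal pairs of the interval through `A ↦ (I ⊔ (D ⊓ Aᶜ), I ⊔ A)`. -/
theorem antipodalCount_one_three_le (a b c : V) {I D : Config E} (hID : I ⊓ D = ⊥) :
    G.antipodalCount ![a, b, c] I D 1 3 ≤
      pairCountIn (I ⊔ D) I (G.sepEvent a b ∩ G.sepEvent a c) (G.connEvent a b ∪ G.connEvent a c) := by
  unfold antipodalCount
  refine card_le_pairCountIn _ (fun A => (I ⊔ (D ⊓ Aᶜ), I ⊔ A)) _ _ _ _ (fun A hA => ?_)
    (fun A hA B hB hAB => ?_)
  · rw [Finset.mem_filter] at hA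
    obtain ⟨_, hAD, h1, h3⟩ := hA
    rw [G.markClasses_eq_one_iff, allConn3, Finset.mem_filter] at h1
    rw [G.markClasses_eq_three_iff, allSep3, Finset.mem_filter] at h3
    exact ⟨pair_mem_antipodalPairs hAD, ⟨h3.2.1, h3.2.2.2⟩, Or.inl h1.2.1⟩
  · simp only [Prod.mk.injEq] at hAB
    rw [Finset.mem_coe, Finset.mem_filter] at hA hB
    calc A = (I ⊔ A) ⊓ D := by
          rw [inf_sup_right, hID, bot_sup_eq, inf_eq_left.mpr hA.2.1]
      _ = (I ⊔ B) ⊓ D := by rw [hAB.2]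
      _ = B := by rw [inf_sup_right, hID, bot_sup_eq, inf_eq_left.mpr hB.2.1]

/-- An event inside `Y = onePair3` counts at most `c₂` on the interval. -/
theorem intervalCountIn_le_intervalCount_two (a b c : V) (I D : Config E) (Y : Set (Config E))
    (hY : ∀ ω, ω ∈ Y → ω ∈ G.onePair3 a b c) :
    intervalCountIn I D Y ≤ G.intervalCount ![a, b, c] I D 2 := by
  unfold intervalCountIn intervalCount
  refine Finset.card_le_card fun A hA => ?_
  rw [Finset.mem_filter] at hA
  rw [Finset.mem_filter, G.markClasses_eq_two_iff]
  exact ⟨Finset.mem_univ _, hA.2.1, hY _ hA.2.2⟩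

/-- **ORBIT-2 with constant 1 on every interval** (the class-level twin of GZ24 eq. (final) /
p5's `c021_const_one`): for every interval `[I, I ⊔ D]` with `I ⊓ D = ⊥`, `a₁₃ ≤ c₂`. -/
theorem orbit2_const_one (a b c : V) {I D : Config E} (hID : I ⊓ D = ⊥) :
    G.antipodalCount ![a, b, c] I D 1 3 ≤ G.intervalCount ![a, b, c] I D 2 := by
  have hpart : intervalCountIn I D (G.connEvent a b ∩ G.sepEvent a c) +
      intervalCountIn I D (G.connEvent a c ∩ G.sepEvent a b) +
      intervalCountIn I D (G.connEvent b c ∩ G.sepEvent a b) ≤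
      intervalCountIn I D {ω | ω ∈ G.onePair3 a b c} := by
    refine intervalCountIn_three_le I D _ _ _ _ ?_ ?_ ?_ ?_
    · intro ω h1 h2
      exact h1.2 h2.1
    · intro ω h1 h3
      exact h3.2 h1.1
    · intro ω h2 h3
      exact h3.2 (h2.1.trans h3.1.symm)
    · intro ω h
      simp only [Set.mem_setOf_eq, onePair3, Finset.mem_filter, Finset.mem_univ, true_and]
      rcases h with ⟨hab, hac⟩ | ⟨hac, hab⟩ | ⟨hbc, hab⟩
      · exact ⟨fun h => hac h.2.2, fun h => h.1 hab⟩
      · exact ⟨fun h => hab h.1, fun h => h.2.2 hac⟩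
      · exact ⟨fun h => hab h.1, fun h => h.2.1 hbc⟩
  calc G.antipodalCount ![a, b, c] I D 1 3
      ≤ pairCountIn (I ⊔ D) I (G.sepEvent a b ∩ G.sepEvent a c)
          (G.connEvent a b ∪ G.connEvent a c) := G.antipodalCount_one_three_le a b c hID
    _ ≤ pairCountSnd (I ⊔ D) I (G.connEvent a b ∩ G.sepEvent a c) +
          pairCountSnd (I ⊔ D) I (G.connEvent a c ∩ G.sepEvent a b) +
          pairCountFst (I ⊔ D) I (G.connEvent b c ∩ G.sepEvent a b) :=
        G.gz24_final_classes a b c (I ⊔ D) I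
    _ ≤ intervalCountIn I D (G.connEvent a b ∩ G.sepEvent a c) +
          intervalCountIn I D (G.connEvent a c ∩ G.sepEvent a b) +
          intervalCountIn I D (G.connEvent b c ∩ G.sepEvent a b) :=
        Nat.add_le_add (Nat.add_le_add (pairCountSnd_le_intervalCountIn hID _)
          (pairCountSnd_le_intervalCountIn hID _)) (pairCountFst_le_intervalCountIn hID _)
    _ ≤ intervalCountIn I D {ω | ω ∈ G.onePair3 a b c} := hpart
    _ ≤ G.intervalCount ![a, b, c] I D 2 :=
        G.intervalCountIn_le_intervalCount_two a b c I D _ fun _ h => h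

end MultiGraph

/-- **ORBIT-2 with constant 1, every finite multigraph, every three marks, every interval**: the
constant-1 form of C-021 (`Orbit2` has constant 2). -/
def Orbit2ConstOne : Prop :=
  ∀ {V E : Type} [DecidableEq V] [Fintype V] [Fintype E] [DecidableEq E] (G : MultiGraph V E)
    (a b c : V) (I D : Config E), I ⊓ D = ⊥ →
      G.antipodalCount ![a, b, c] I D 1 3 ≤ G.intervalCount ![a, b, c] I D 2

/-- **`Orbit2ConstOne` is a theorem** (the class-level swap principle on GZ24 eq. (final)). -/
theorem Orbit2ConstOne_holds : Orbit2ConstOne :=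
  fun G a b c _ _ hID => G.orbit2_const_one a b c hID

end PercRepro
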